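import Summits.NavierStokesRegularity.FunctionalMining.StrainBlockReduction
import Summits.NavierStokesRegularity.FunctionalMining.NoGo.DirectorForm
import HarnessLib

/-!
# FunctionalMining — the top eigenVECTOR of `tK + E` near the double top of `K`: top Rayleigh
# vectors are eigenvectors, the tilt out of `n^⊥`, and the in-plane Davis–Kahan angle
# (F1 PART I, Lemma 10 (d))

Search for candidate a priori estimates; no regularity claim. Cell `pub-nsfunc`, prove seat
(gen 22). Kernel form of part (d) of the no-go seat's F1 PART I LEMMA 10 (pen, countersigned in the
cell — not a cited fact), completing (a)–(c) (`StrainBlockWindow*.lean`) and (b)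
(`StrainBlockReduction.lean`). Frame `ℝ³ = n^⊥ ⊕ ℝn`,
`S = [[tm + B₀₀, B₀₁, b₀], [B₀₁, tm + B₁₁, b₁], [b₀, b₁, −2tm + e_nn]]`.

* **`BlockReduction.mulVec_eq_smul_of_ray_eq_lam1`** — for a symmetric matrix, a unit vector
  attaining the top Rayleigh value `λ₁ = lam1` IS an eigenvector: `M e = λ₁ e` (the bridge from the
  Rayleigh-sup files to the eigen-equation files; proof pattern as in the tree's
  `Literature…AHRiccati.mulVec_eq_smul_of_rayleigh_min`);
* **`BlockReduction.tilt_sq_le`** (TILT): an eigenvector `(w, s)` of `S` at a level `λ` with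
  `D(λ) = λ + 2tm − e_nn` satisfies `s·D = ⟨b, w⟩` (Lemma 10 (b)), hence `(sD)² ≤ |b|²|w|²`; with
  `|b|² ≤ ε²`, `D ≥ 3tm − 2ε > 0`: `s²(3tm − 2ε)² ≤ ε²|w|²`, i.e. `|tan α| ≤ ε/(3tm − 2ε)`
  (`BlockReduction.tilt_sq_le_window`);
* `BlockReduction.perp_decomp_fin2`, `BlockReduction.mulVec_perp_of_eigen_fin2` — in `ℝ²`, the
  rotated vector `w̄⊥ = (−w̄₁, w̄₀)` of a unit eigenvector `w̄` of a symmetric `2 × 2` matrix is an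
  eigenvector with the complementary Rayleigh value `tr − β̄₁`;
* **`BlockReduction.davisKahan_identity_fin2`** (IN-PLANE ANGLE, exact form): if `M w = β w` and
  `M̄ w̄ = β̄₁ w̄` (unit `w̄`, `M̄` symmetric, `β̄₂ := tr M̄ − β̄₁`), then
  `(β − β̄₂)·⟨w̄⊥, w⟩ = ⟨w̄⊥, (M − M̄) w⟩`; hence (`BlockReduction.davisKahan_sin_le_fin2`)
  `|β − β̄₂|·|⟨w̄⊥, w⟩| ≤ |⟨w̄⊥,(M − M̄)w⟩|` — with `‖M − M̄‖ ≤ R*` and `β − β̄₂ ≥ γ̄ − R*` this is the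
  pen's `sin∠(w₁, w̄) ≤ R*/(γ̄ − R*)`.

Elementary linear algebra over `ℝ`. [ours; folklore — Rayleigh–Ritz, Davis–Kahan `sin Θ` in
dimension two]
-/

noncomputable section

open Matrix

namespace Summit.NavierStokesRegularity.FunctionalMining

open SharpClass.DirectorForm

namespace BlockReduction

/-! ## 1. Top Rayleigh vectors of a symmetric matrix are eigenvectors -/

/-- For a symmetric matrix, `aᵀ M b = bᵀ M a`. [folklore] -/
theorem ray_comm_of_isSymm {d : Type*} [Fintype d] {M : Matrix d d ℝ} (hM : M.IsSymm)
    (a b : d → ℝ) : a ⬝ᵥ M *ᵥ b = b ⬝ᵥ M *ᵥ a := by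
  rw [dotProduct_mulVec, ← Matrix.mulVec_transpose, hM.eq, dotProduct_comm]

/-- **A unit vector attaining the top Rayleigh value of a symmetric matrix is an eigenvector**:
`eᵀe = 1`, `eᵀMe = λ₁(M)` ⇒ `M e = λ₁(M) e`. (With `w := Me − λ₁e`: testing the Rayleigh bound at
`e + τw` gives `2τ|w|² ≤ τ²(λ₁|w|² − wᵀMw)` for all `τ`, impossible for small `τ > 0` unless `w = 0`.)
[folklore — Rayleigh–Ritz] -/
theorem mulVec_eq_smul_of_ray_eq_lam1 {d : Type*} [Fintype d] [DecidableEq d] [Nonempty d]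
    {M : Matrix d d ℝ} (hM : M.IsSymm) {e : d → ℝ} (he : e ⬝ᵥ e = 1)
    (htop : e ⬝ᵥ M *ᵥ e = lam1 M) : M *ᵥ e = lam1 M • e := by
  set lam := lam1 M with hlam
  set w := M *ᵥ e - lam • e with hw
  rw [← sub_eq_zero]
  show w = 0
  set A := w ⬝ᵥ w with hA
  set B := lam * (w ⬝ᵥ w) - w ⬝ᵥ M *ᵥ w with hB
  have hA0 : 0 ≤ A := TopEig.dotProduct_self_nonneg' w
  have hB0 : 0 ≤ B := by
    have h := TopEig.quad_le_lam_mul (flat M) w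
    rw [quad_flat] at h
    change w ⬝ᵥ M *ᵥ w ≤ lam1 M * (w ⬝ᵥ w) at h
    rw [hB]; linarith
  have hAw : A = w ⬝ᵥ M *ᵥ e - lam * (w ⬝ᵥ e) := by
    rw [hA]
    conv_lhs => rw [show w = M *ᵥ e - lam • e from rfl]
    rw [dotProduct_sub, dotProduct_smul, smul_eq_mul]
  have hsymm : e ⬝ᵥ M *ᵥ w = w ⬝ᵥ M *ᵥ e := ray_comm_of_isSymm hM e w
  have hcomm : e ⬝ᵥ w = w ⬝ᵥ e := dotProduct_comm e w
  -- `2τA ≤ τ²B` for every `τ`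
  have key : ∀ τ : ℝ, 2 * τ * A ≤ τ ^ 2 * B := by
    intro τ
    have hq := TopEig.quad_le_lam_mul (flat M) (e + τ • w)
    rw [quad_flat] at hq
    have e1 : (e + τ • w) ⬝ᵥ M *ᵥ (e + τ • w) =
        e ⬝ᵥ M *ᵥ e + τ * (e ⬝ᵥ M *ᵥ w) + τ * (w ⬝ᵥ M *ᵥ e) + τ ^ 2 * (w ⬝ᵥ M *ᵥ w) := by
      simp only [Matrix.mulVec_add, Matrix.mulVec_smul, dotProduct_add, add_dotProduct,
        dotProduct_smul, smul_dotProduct, smul_eq_mul]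
      ring
    have e2 : (e + τ • w) ⬝ᵥ (e + τ • w) =
        e ⬝ᵥ e + τ * (e ⬝ᵥ w) + τ * (w ⬝ᵥ e) + τ ^ 2 * (w ⬝ᵥ w) := by
      simp only [dotProduct_add, add_dotProduct, dotProduct_smul, smul_dotProduct, smul_eq_mul]
      ring
    rw [e1, e2, hsymm, hcomm, he, htop] at hq
    change lam + τ * (w ⬝ᵥ M *ᵥ e) + τ * (w ⬝ᵥ M *ᵥ e) + τ ^ 2 * (w ⬝ᵥ M *ᵥ w) ≤
      lam * (1 + τ * (w ⬝ᵥ e) + τ * (w ⬝ᵥ e) + τ ^ 2 * (w ⬝ᵥ w)) at hq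
    rw [hAw, hB]
    nlinarith [hq]
  by_contra hw0
  have hApos : 0 < A := by
    rcases hA0.eq_or_lt with h | h
    · exfalso
      exact hw0 (dotProduct_self_eq_zero.1 h.symm)
    · exact h
  -- choose `τ = A/(B + 1) > 0`: `2A ≤ τ B < A`
  have hB1 : 0 < B + 1 := by linarith
  have hτ := key (A / (B + 1))
  have h1 : 2 * (A / (B + 1)) * A ≤ (A / (B + 1)) ^ 2 * B := hτ
  have h2 : (A / (B + 1)) ^ 2 * B < (A / (B + 1)) * A := by
    have hτpos : 0 < A / (B + 1) := div_pos hApos hB1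
    have h3 : A / (B + 1) * B < A := by
      rw [div_mul_eq_mul_div, div_lt_iff₀ hB1]
      nlinarith
    nlinarith [hτpos, h3]
  nlinarith [h1, h2, div_pos hApos hB1]

/-! ## 2. The tilt out of `n^⊥` (Lemma 10 (d), first clause) -/

/-- **TILT.** An eigenvector `(w₀, w₁, s)` of `S` at the level `λ` satisfies
`(s·D(λ))² ≤ |b|²|w|²`, `D(λ) = λ + 2tm − e_nn` — by Lemma 10 (b) (`s D = ⟨b, w⟩`) and
Cauchy–Schwarz. [ours; F1 PART I Lemma 10 (d)] -/
theorem tilt_sq_le {t m B00 B01 B11 b0 b1 enn lam w0 w1 s : ℝ}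
    (h : !![t * m + B00, B01, b0; B01, t * m + B11, b1; b0, b1, -2 * (t * m) + enn] *ᵥ ![w0, w1, s] =
      lam • ![w0, w1, s]) :
    (s * (lam + 2 * (t * m) - enn)) ^ 2 ≤ (b0 ^ 2 + b1 ^ 2) * (w0 ^ 2 + w1 ^ 2) := by
  obtain ⟨h1, -, -⟩ := reduction h
  rw [h1]
  nlinarith [sq_nonneg (b0 * w1 - b1 * w0)]

/-- **TILT, window form**: if moreover `|b|² ≤ ε²` and `D(λ) ≥ 3tm − 2ε ≥ 0` then
`s²(3tm − 2ε)² ≤ ε²|w|²`, i.e. `|tan α| = |s|/|w| ≤ ε/(3tm − 2ε)`. [ours; F1 PART I Lemma 10 (d)] -/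
theorem tilt_sq_le_window {t m B00 B01 B11 b0 b1 enn lam w0 w1 s ε : ℝ}
    (h : !![t * m + B00, B01, b0; B01, t * m + B11, b1; b0, b1, -2 * (t * m) + enn] *ᵥ ![w0, w1, s] =
      lam • ![w0, w1, s])
    (hb : b0 ^ 2 + b1 ^ 2 ≤ ε ^ 2) (hgap : 0 ≤ 3 * (t * m) - 2 * ε)
    (hD : 3 * (t * m) - 2 * ε ≤ lam + 2 * (t * m) - enn) :
    s ^ 2 * (3 * (t * m) - 2 * ε) ^ 2 ≤ ε ^ 2 * (w0 ^ 2 + w1 ^ 2) := by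
  have h1 := tilt_sq_le h
  have hw : 0 ≤ w0 ^ 2 + w1 ^ 2 := by positivity
  have h2 : (s * (3 * (t * m) - 2 * ε)) ^ 2 ≤ (s * (lam + 2 * (t * m) - enn)) ^ 2 := by
    rw [mul_pow, mul_pow]
    exact mul_le_mul_of_nonneg_left (pow_le_pow_left₀ hgap hD 2) (sq_nonneg s)
  calc s ^ 2 * (3 * (t * m) - 2 * ε) ^ 2 = (s * (3 * (t * m) - 2 * ε)) ^ 2 := by ring
    _ ≤ (s * (lam + 2 * (t * m) - enn)) ^ 2 := h2
    _ ≤ (b0 ^ 2 + b1 ^ 2) * (w0 ^ 2 + w1 ^ 2) := h1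
    _ ≤ ε ^ 2 * (w0 ^ 2 + w1 ^ 2) := mul_le_mul_of_nonneg_right hb hw

/-! ## 3. The in-plane angle: Davis–Kahan in dimension two (Lemma 10 (d), second clause) -/

/-- Decomposition of `ℝ²` along a unit vector `w̄` and its rotation `w̄⊥ = (−w̄₁, w̄₀)`:
`y = ⟨y, w̄⟩ w̄ + ⟨y, w̄⊥⟩ w̄⊥`. [folklore] -/
theorem perp_decomp_fin2 {wb : Fin 2 → ℝ} (hwb : wb ⬝ᵥ wb = 1) (y : Fin 2 → ℝ) :
    y = (y ⬝ᵥ wb) • wb + (y ⬝ᵥ ![-wb 1, wb 0]) • ![-wb 1, wb 0] := by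
  simp only [dotProduct, Fin.sum_univ_two] at hwb
  ext i
  fin_cases i
  · simp [dotProduct, Fin.sum_univ_two]
    linear_combination (-(y 0)) * hwb
  · simp [dotProduct, Fin.sum_univ_two]
    linear_combination (-(y 1)) * hwb

/-- **In `ℝ²` the rotation of a unit eigenvector of a symmetric matrix is an eigenvector with the
complementary Rayleigh value**: `M̄ w̄ = β̄₁ w̄`, `|w̄| = 1` ⇒ `M̄ w̄⊥ = (tr M̄ − β̄₁) w̄⊥`, where
`tr M̄ − β̄₁ = w̄⊥ᵀ M̄ w̄⊥`. [folklore] -/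
theorem mulVec_perp_of_eigen_fin2 {Mb : Matrix (Fin 2) (Fin 2) ℝ} (hMb : Mb.IsSymm) {wb : Fin 2 → ℝ}
    {β1 : ℝ} (hwb : wb ⬝ᵥ wb = 1) (heig : Mb *ᵥ wb = β1 • wb) :
    Mb *ᵥ ![-wb 1, wb 0] = (Mb 0 0 + Mb 1 1 - β1) • ![-wb 1, wb 0] := by
  set wp : Fin 2 → ℝ := ![-wb 1, wb 0] with hwp
  -- `M̄ w̄⊥ ⊥ w̄`
  have hwpwb : wp ⬝ᵥ wb = 0 := by
    simp [hwp, dotProduct, Fin.sum_univ_two]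
    ring
  have hperp : (Mb *ᵥ wp) ⬝ᵥ wb = 0 := by
    rw [dotProduct_comm, ray_comm_of_isSymm hMb wb wp, heig, dotProduct_smul, smul_eq_mul, hwpwb,
      mul_zero]
  -- Rayleigh value of `w̄⊥`: `a w̄₁² − 2b w̄₀w̄₁ + c w̄₀² = (a + c) − β̄₁`
  have hunit' : wb 0 ^ 2 + wb 1 ^ 2 = 1 := by
    simp only [dotProduct, Fin.sum_univ_two, ← pow_two] at hwb; exact hwb
  have h01 : Mb 0 1 = Mb 1 0 := by simpa using hMb.apply 1 0
  have hray : (Mb *ᵥ wp) ⬝ᵥ wp = Mb 0 0 + Mb 1 1 - β1 := by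
    -- from the eigen-equation: `β̄₁ = w̄ᵀ M̄ w̄ = a w̄₀² + 2b w̄₀ w̄₁ + c w̄₁²`
    have r0 := congrFun heig 0
    have r1 := congrFun heig 1
    simp [Matrix.mulVec, dotProduct, Fin.sum_univ_two] at r0 r1
    simp [hwp, Matrix.mulVec, dotProduct, Fin.sum_univ_two]
    rw [h01] at r0 ⊢
    linear_combination (-wb 0) * r0 + (-wb 1) * r1 + (Mb 0 0 + Mb 1 1 - β1) * hunit'
  rw [perp_decomp_fin2 hwb (Mb *ᵥ wp), hperp, zero_smul, zero_add, hray]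

/-- **DAVIS–KAHAN IN DIMENSION TWO, exact form.** `M w = β w`, `M̄` symmetric with unit eigenvector
`M̄ w̄ = β̄₁ w̄`, `β̄₂ := tr M̄ − β̄₁`, `w̄⊥ = (−w̄₁, w̄₀)`: then
`(β − β̄₂)·⟨w̄⊥, w⟩ = ⟨w̄⊥, (M − M̄) w⟩`. [folklore; F1 PART I Lemma 10 (d)] -/
theorem davisKahan_identity_fin2 {M Mb : Matrix (Fin 2) (Fin 2) ℝ} (hMb : Mb.IsSymm) {w wb : Fin 2 → ℝ}
    {β β1 : ℝ} (hw : M *ᵥ w = β • w) (hwb : wb ⬝ᵥ wb = 1) (heig : Mb *ᵥ wb = β1 • wb) :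
    (β - (Mb 0 0 + Mb 1 1 - β1)) * (![-wb 1, wb 0] ⬝ᵥ w) = ![-wb 1, wb 0] ⬝ᵥ (M - Mb) *ᵥ w := by
  have hperp := mulVec_perp_of_eigen_fin2 hMb hwb heig
  rw [Matrix.sub_mulVec, dotProduct_sub, hw, dotProduct_smul, smul_eq_mul,
    ray_comm_of_isSymm hMb _ w, hperp, dotProduct_smul, smul_eq_mul, dotProduct_comm w]
  ring

/-- **DAVIS–KAHAN IN DIMENSION TWO, `sin Θ` bound**: with the notation above,
`|β − β̄₂|·|⟨w̄⊥, w⟩| ≤ |⟨w̄⊥, (M − M̄)w⟩|`; for unit `w` the left factor `|⟨w̄⊥, w⟩|` is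
`|sin∠(w, w̄)|`, and in Lemma 10 `|⟨w̄⊥,(M − M̄)w⟩| ≤ R*`, `β − β̄₂ ≥ γ̄ − R*` give
`sin∠(w₁, w̄) ≤ R*/(γ̄ − R*)`. [folklore; F1 PART I Lemma 10 (d)] -/
theorem davisKahan_sin_le_fin2 {M Mb : Matrix (Fin 2) (Fin 2) ℝ} (hMb : Mb.IsSymm) {w wb : Fin 2 → ℝ}
    {β β1 r : ℝ} (hw : M *ᵥ w = β • w) (hwb : wb ⬝ᵥ wb = 1) (heig : Mb *ᵥ wb = β1 • wb)
    (hE : |![-wb 1, wb 0] ⬝ᵥ (M - Mb) *ᵥ w| ≤ r) :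
    |β - (Mb 0 0 + Mb 1 1 - β1)| * |![-wb 1, wb 0] ⬝ᵥ w| ≤ r := by
  rw [← abs_mul, davisKahan_identity_fin2 hMb hw hwb heig]
  exact hE

/-- The rank-one perturbation of Lemma 10: for the reduced forms `M(λ) − M̄ = (1/D − 1/(3tm))·b⊗b`,
`|xᵀ(M − M̄)y| = |1/D − 1/(3tm)|·|⟨b,x⟩|·|⟨b,y⟩| ≤ |1/D − 1/(3tm)|·|b|²` for unit `x, y` in `ℝ²`
(the `r` of `davisKahan_sin_le_fin2` is `≤ R*`). [ours] -/
theorem abs_rankOne_ray_le {b0 b1 c : ℝ} {x y : Fin 2 → ℝ} (hx : x ⬝ᵥ x = 1) (hy : y ⬝ᵥ y = 1) :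
    |x ⬝ᵥ (c • Matrix.vecMulVec ![b0, b1] ![b0, b1]) *ᵥ y| ≤ |c| * (b0 ^ 2 + b1 ^ 2) := by
  simp only [dotProduct, Fin.sum_univ_two, ← pow_two] at hx hy
  have hval : x ⬝ᵥ (c • Matrix.vecMulVec ![b0, b1] ![b0, b1]) *ᵥ y =
      c * ((b0 * x 0 + b1 * x 1) * (b0 * y 0 + b1 * y 1)) := by
    simp [Matrix.mulVec, dotProduct, Fin.sum_univ_two]
    ring
  rw [hval, abs_mul]
  refine mul_le_mul_of_nonneg_left ?_ (abs_nonneg c)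
  have hCSx : (b0 * x 0 + b1 * x 1) ^ 2 ≤ b0 ^ 2 + b1 ^ 2 := by
    nlinarith [sq_nonneg (b0 * x 1 - b1 * x 0)]
  have hCSy : (b0 * y 0 + b1 * y 1) ^ 2 ≤ b0 ^ 2 + b1 ^ 2 := by
    nlinarith [sq_nonneg (b0 * y 1 - b1 * y 0)]
  rw [abs_le]
  constructor
  · nlinarith [sq_nonneg (b0 * x 0 + b1 * x 1 + (b0 * y 0 + b1 * y 1)), hCSx, hCSy]
  · nlinarith [sq_nonneg (b0 * x 0 + b1 * x 1 - (b0 * y 0 + b1 * y 1)), hCSx, hCSy]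

end BlockReduction

end Summit.NavierStokesRegularity.FunctionalMining

end
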